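import Summits.BirchSwinnertonDyer.BirchSwinnertonDyer.Theorems.UniversalToricDescentTwoSidedMuTransferPackage
import HarnessLib

/-!
# Route UniversalToricDescent — the two-sided link in `μ`-currency: PACKAGE ASSEMBLY WITH K2 IN `μ`-CURRENCY
# (and the K1-collapse of K2), any prime `p`

Lead prover bsd-wall-utd-p1 g22 (`--supports stmt-BirchSwinnertonDyer-24737`, crux `TwinAlgMuZeroAtThree` R2, registered
line `beta-road`); fourth file of the series `…TwoSidedMuTransfer` (p730564) / `…Howard` (p730950) / `…Package` (p731400).

The registered composition of `beta-road` feeds `isTorsion_and_exists_generator_of_package` with Howard's divisibility K2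
in CHARACTERISTIC-IDEAL currency (`Ch(X_tors) ∣ Ch(𝔖/ℋ)²`). The composition only ever reads K2 through `μ`; this file
records the exact weaker forms that suffice, so that a reshape of the research stub `stub_howardMult` to `μ`-currency
(or its replacement by a residual / Ω-adic corank argument, node `residual_omega_kolyvagin`) is count-neutral:

* §1 `muInvariant_quotient_span_eq_zero_of_not_mem_augIdealP` — **K1 collapses the index**: `𝔖` finitely generated
  torsion-free of rank one, `loc : 𝔖 → Λ` linear, `loc κ ∉ (p)` ⟹ `μ(𝔖/Λκ) = 0` AND `μ(Λ/loc 𝔖) = 0`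
  ((A.4): `μ(Λ/Λ·loc κ) = μ(𝔖/Λκ) + μ(Λ/loc 𝔖)` and `μ(Λ/Λ·loc κ) = 0`).
* §2 `isTorsion_and_exists_generator_of_package_mu` — PACKAGE + K2μ `μ(X_tors) ≤ 2·μ(𝔖/Λκ)` + K1 ⟹ the conclusion of
  `TwinAlgMuZeroAtThree` at `X₀ = X_{∅,0}`.
* §3 `isTorsion_and_exists_generator_of_package_muZero` — PACKAGE + `μ(X_tors) = 0` + K1 ⟹ the same (the form an
  Ω-adic / residual-corank theorem delivers: `μ(X_tors) = 0` with no Heegner index at all).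
* §4 `howardMu_of_charIdeal_dvd` — the registered char-ideal K2 (any `ℋ ∋ κ`) implies K2μ, so §2 is WEAKER-or-equal
  than what `beta-road` currently asks.

THEOREMS ONLY; no `Theses` import; std axioms. BSD is not advanced by this file; stmt-24737 stays open.
References: [Castella2017HeegnerBeilinsonFlach] App. A (A.4)–(A.7); [Howard2004HeegnerKolyvagin] Thm. B; [Washington1997] §13.2.
-/

noncomputable section
open scoped Classical

-- `…BirchSwinnertonDyer.BirchSwinnertonDyer.Theorems…` is the problem's mandated namespace (D-0017).
set_option linter.dupNamespace false
set_option autoImplicit false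

namespace Summit.BirchSwinnertonDyer.BirchSwinnertonDyer.Theorems.UniversalToricDescentTwoSidedMuTransfer

open Literature.NumberTheory.EllipticCurves Literature.NumberTheory.EllipticCurves.IwasawaAlgebra
  Literature.NumberTheory.EllipticCurves.Module
  Summit.BirchSwinnertonDyer.BirchSwinnertonDyer.Theorems.UniversalToricDescentAcDualMuZero

variable {p : ℕ} [Fact p.Prime]

/-! ### §1 K1 collapses the Heegner index in `μ`-currency -/

/-- **K1 ⟹ `μ(𝔖/Λκ) = 0` and `μ(Λ/loc 𝔖) = 0`.** For `𝔖` finitely generated, torsion-free of rank one, a linear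
`loc : 𝔖 → Λ` and `κ ∈ 𝔖` with `loc κ ∉ (p)`: `loc` is injective (rank one), the tautological sequence (A.4)
`0 → 𝔖/Λκ → Λ/Λ·loc κ → Λ/loc 𝔖 → 0` is exact and `μ(Λ/Λ·loc κ) = 0`, so both outer `μ` vanish.
[cite: Castella2017HeegnerBeilinsonFlach, App. A, (A.4) (arXiv:1509.02761 p. 19)] [cite: Washington1997, §13.2] -/
theorem muInvariant_quotient_span_eq_zero_of_not_mem_augIdealP {S : Type*}
    [AddCommGroup S] [Module (IwasawaAlgebra p) S] [Module.Finite (IwasawaAlgebra p) S]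
    [NoZeroSMulDivisors (IwasawaAlgebra p) S]
    (h1 : Module.finrank (IwasawaAlgebra p) S = 1) (κ : S)
    (loc : S →ₗ[IwasawaAlgebra p] IwasawaAlgebra p) (hβ : loc κ ∉ augIdealP p) :
    muInvariant p (S ⧸ Submodule.span (IwasawaAlgebra p) {κ}) = 0 ∧
      muInvariant p (IwasawaAlgebra p ⧸ LinearMap.range loc) = 0 := by
  have hloc0 : loc κ ≠ 0 := fun h => hβ (h ▸ Submodule.zero_mem _)
  have hκ0 : κ ≠ 0 := fun h => hloc0 (by rw [h, map_zero])
  have hSκ := isTorsion_quotient_span_of_finrank_eq_one h1 hκ0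
  have hinj : Function.Injective loc := injective_of_isTorsion_quotient loc κ hSκ hloc0
  obtain ⟨hTΛ, hμ0⟩ := isTorsion_and_muInvariant_eq_zero_quotient_of_not_mem_augIdealP hβ
  have hA4 := muInvariant_quotient_span_eq_add loc hinj κ hTΛ
  constructor <;> omega

/-! ### §2 Package + K2 in `μ`-currency + K1 -/

/-- **Package + K2μ + K1 ⟹ the conclusion of `TwinAlgMuZeroAtThree` at `X₀ = X_{∅,0}`.** As
`isTorsion_and_exists_generator_of_package`, with Howard's divisibility replaced by its `μ`-shadow
`μ(X_tors) ≤ 2·μ(𝔖/Λκ)` (K2μ). Proof: K1 gives `μ(𝔖/Λκ) = μ(Λ/loc 𝔖) = 0` (§1), so the package inequality reads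
`μ(X₀) ≤ μ(X_tors) ≤ 0`. [cite: Castella2017HeegnerBeilinsonFlach, App. A, Lemmas A.2–A.4 (arXiv:1509.02761 pp. 18–20)]
[cite: Howard2004HeegnerKolyvagin, Thm. B] -/
theorem isTorsion_and_exists_generator_of_package_mu {S X X₀ : Type*}
    [AddCommGroup S] [Module (IwasawaAlgebra p) S] [Module.Finite (IwasawaAlgebra p) S]
    [NoZeroSMulDivisors (IwasawaAlgebra p) S]
    [AddCommGroup X] [Module (IwasawaAlgebra p) X]
    [AddCommGroup X₀] [Module (IwasawaAlgebra p) X₀] [Module.Finite (IwasawaAlgebra p) X₀]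
    (h1 : Module.finrank (IwasawaAlgebra p) S = 1) (κ : S)
    (loc : S →ₗ[IwasawaAlgebra p] IwasawaAlgebra p)
    (hpkg : loc κ ≠ 0 → Module.IsTorsion (IwasawaAlgebra p) X₀ ∧
      muInvariant p X₀ ≤ muInvariant p (Submodule.torsion (IwasawaAlgebra p) X) +
        2 * muInvariant p (IwasawaAlgebra p ⧸ LinearMap.range loc))
    (hK2μ : muInvariant p (Submodule.torsion (IwasawaAlgebra p) X) ≤
      2 * muInvariant p (S ⧸ Submodule.span (IwasawaAlgebra p) {κ}))
    (hβ : loc κ ∉ augIdealP p) :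
    Module.IsTorsion (IwasawaAlgebra p) X₀ ∧
      ∃ g : UnrSeries p,
        (Module.charIdeal (IwasawaAlgebra p) X₀).map
            (PowerSeries.map (Summit.BirchSwinnertonDyer.Rank1Residual.X11b.Halves.toUnr p)) =
          Ideal.span {g} ∧
          ∃ i : ℕ, ‖((PowerSeries.coeff i g : unrIntegers p) : ℂ_[p])‖ = 1 := by
  have hloc0 : loc κ ≠ 0 := fun h => hβ (h ▸ Submodule.zero_mem _)
  obtain ⟨hX₀, hle⟩ := hpkg hloc0
  obtain ⟨hμS, hμC⟩ := muInvariant_quotient_span_eq_zero_of_not_mem_augIdealP h1 κ loc hβ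
  have hμ : muInvariant p X₀ = 0 := by omega
  exact ⟨hX₀, exists_map_charIdeal_eq_span_of_muInvariant_eq_zero X₀ hX₀ hμ⟩

/-! ### §3 Package + `μ(X_tors) = 0` + K1 -/

/-- **Package + `μ(X_tors) = 0` + K1 ⟹ the conclusion of `TwinAlgMuZeroAtThree` at `X₀ = X_{∅,0}`** (the input
shape of a residual / Ω-adic corank theorem: no Heegner index, no characteristic ideal).
[cite: Castella2017HeegnerBeilinsonFlach, App. A, Lemma A.4 (arXiv:1509.02761 pp. 19–20)] -/
theorem isTorsion_and_exists_generator_of_package_muZero {S X X₀ : Type*}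
    [AddCommGroup S] [Module (IwasawaAlgebra p) S] [Module.Finite (IwasawaAlgebra p) S]
    [NoZeroSMulDivisors (IwasawaAlgebra p) S]
    [AddCommGroup X] [Module (IwasawaAlgebra p) X]
    [AddCommGroup X₀] [Module (IwasawaAlgebra p) X₀] [Module.Finite (IwasawaAlgebra p) X₀]
    (h1 : Module.finrank (IwasawaAlgebra p) S = 1) (κ : S)
    (loc : S →ₗ[IwasawaAlgebra p] IwasawaAlgebra p)
    (hpkg : loc κ ≠ 0 → Module.IsTorsion (IwasawaAlgebra p) X₀ ∧
      muInvariant p X₀ ≤ muInvariant p (Submodule.torsion (IwasawaAlgebra p) X) +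
        2 * muInvariant p (IwasawaAlgebra p ⧸ LinearMap.range loc))
    (hμX : muInvariant p (Submodule.torsion (IwasawaAlgebra p) X) = 0)
    (hβ : loc κ ∉ augIdealP p) :
    Module.IsTorsion (IwasawaAlgebra p) X₀ ∧
      ∃ g : UnrSeries p,
        (Module.charIdeal (IwasawaAlgebra p) X₀).map
            (PowerSeries.map (Summit.BirchSwinnertonDyer.Rank1Residual.X11b.Halves.toUnr p)) =
          Ideal.span {g} ∧
          ∃ i : ℕ, ‖((PowerSeries.coeff i g : unrIntegers p) : ℂ_[p])‖ = 1 :=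
  isTorsion_and_exists_generator_of_package_mu h1 κ loc hpkg (by rw [hμX]; exact Nat.zero_le _) hβ

/-! ### §4 The registered char-ideal K2 implies K2μ -/

/-- **Howard's divisibility (any `ℋ ∋ κ`, char-ideal currency) ⟹ K2μ.** For `𝔖` finitely generated torsion-free of
rank one, `0 ≠ κ ∈ ℋ ≤ 𝔖`, `X` finitely generated with `Ch(X_tors) ∣ Ch(𝔖/ℋ)²`: `μ(X_tors) ≤ 2·μ(𝔖/Λκ)`
(`𝔖/ℋ` is a torsion quotient of the torsion module `𝔖/Λκ`). [cite: Howard2004HeegnerKolyvagin, Thm. B]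
[cite: Washington1997, §13.2] -/
theorem howardMu_of_charIdeal_dvd {S X : Type*}
    [AddCommGroup S] [Module (IwasawaAlgebra p) S] [Module.Finite (IwasawaAlgebra p) S]
    [NoZeroSMulDivisors (IwasawaAlgebra p) S]
    [AddCommGroup X] [Module (IwasawaAlgebra p) X] [Module.Finite (IwasawaAlgebra p) X]
    (h1 : Module.finrank (IwasawaAlgebra p) S = 1) {κ : S} (hκ : κ ≠ 0)
    (H : Submodule (IwasawaAlgebra p) S) (hκH : κ ∈ H)
    (hHoward : Module.charIdeal (IwasawaAlgebra p) (Submodule.torsion (IwasawaAlgebra p) X) ∣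
      Module.charIdeal (IwasawaAlgebra p) (S ⧸ H) ^ 2) :
    muInvariant p (Submodule.torsion (IwasawaAlgebra p) X) ≤
      2 * muInvariant p (S ⧸ Submodule.span (IwasawaAlgebra p) {κ}) := by
  have hSκ := isTorsion_quotient_span_of_finrank_eq_one h1 hκ
  haveI : IsNoetherian (IwasawaAlgebra p) X := isNoetherian_of_isNoetherianRing_of_finite _ _
  haveI : Module.Finite (IwasawaAlgebra p) (Submodule.torsion (IwasawaAlgebra p) X) :=
    Module.Finite.iff_fg.mpr (IsNoetherian.noetherian _)
  have hleH : Submodule.span (IwasawaAlgebra p) {κ} ≤ H.comap LinearMap.id := by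
    rw [Submodule.comap_id, Submodule.span_singleton_le_iff_mem]; exact hκH
  have hSH : Module.IsTorsion (IwasawaAlgebra p) (S ⧸ H) :=
    Literature.NumberTheory.EllipticCurves.isTorsion_of_surjective (Submodule.mapQ _ _ LinearMap.id hleH)
      (fun y => by
        induction y using Submodule.Quotient.induction_on with
        | H s => exact ⟨Submodule.Quotient.mk s, by rw [Submodule.mapQ_apply, LinearMap.id_apply]⟩) hSκ
  have hHow1 := muInvariant_le_mul_of_charIdeal_dvd_pow
    (Submodule.torsion_isTorsion (R := IwasawaAlgebra p) (M := X)) hSH 2 hHoward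
  have hHow2 := muInvariant_quotient_le_of_mem H hκH hSκ
  omega

end Summit.BirchSwinnertonDyer.BirchSwinnertonDyer.Theorems.UniversalToricDescentTwoSidedMuTransfer

end
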